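import Summits.Ventures.HodgeRepro2.T5BergmanIntegrableCoeff

/-!
# The `K`-finite matrix coefficients of `π₃⁺` are integrable on `SU(1,1)`

The missing case `k = 3` of `T5BergmanIntegrableCoeff`: `|a(g)|^{-3}` is integrable against every Haar
measure of `SU(1,1)`. Through the fibration `SU(1,1) = 𝔻 × K` (`T5SU11FibrationHaar`) this is the
integrability of `(1 - |z|²)^{3/2}` against the Poincaré measure `(1 - |z|²)^{-2} dA`, i.e.

  `∫_𝔻 (1 - |z|²)^{-1/2} dA < ∞`   (`integrableOn_ball_rpow`),

a HALF-INTEGER power: in polar coordinates (`T5BergmanParseval.lintegral_ball_eq_polar`) the radial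
integrand `r (1 - r²)^{-1/2}` is dominated by `(1 - r)^{-1/2}`, integrable on `(0,1)` by Mathlib's
`intervalIntegral.integrableOn_Ioo_rpow_iff` (`-1 < -1/2`) and the reflection `r ↦ 1 - r`.
With the decay bound `|⟨π_3(g) zᵐ, zⁿ⟩_3| ≤ C_{m,n} ⟨zⁿ,zⁿ⟩_3 |a(g)|^{-3}` of `T5BergmanKTypeMatrix`:

* `integrable_matrixCoeff_monomial_monomial_three`: every `K`-finite matrix coefficient of the weight-`3`
  model `π₃⁺` is integrable on `SU(1,1)` against every Haar measure — `π₃⁺` is an integrable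
  representation (the weight of `N4.3`).

Blind lane: Mathlib + the HodgeRepro2 prefix only; no sorry; axioms ⊆ {propext, Classical.choice,
Quot.sound}.
-/

namespace Summit.Ventures.HodgeRepro2.T5BergmanIntegrableCoeffThree

open MeasureTheory MeasureTheory.Measure Metric Filter Topology Set
open T5PoincareDensity T5PoincareMeasure T5SU11Unimodular T5SU11Fibration T5SU11FibrationHaar
  T5SU11FibrationCartan T5HaarCircle
open T5BergmanCoefficient T5BergmanPairing T5BergmanFourier T5BergmanParseval T5BergmanActStable
  T5BergmanMatrixCoeff T5BergmanSchur T5BergmanKTypeMatrix T5BergmanIntegrableCoeff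
open scoped Real ENNReal NNReal

/-! ### The radial integral `∫_0^1 r (1 - r²)^{-1/2} dr < ∞` -/

/-- `(1 - r)^{-1/2}` is integrable on `(0, 1)` (Mathlib's `x^s` on `(0,1)` for `-1 < s`, reflected). -/
lemma integrableOn_one_sub_rpow :
    IntegrableOn (fun r : ℝ => (1 - r) ^ (-(1 / 2 : ℝ))) (Ioo (0 : ℝ) 1) := by
  have h1 : IntegrableOn (fun x : ℝ => x ^ (-(1 / 2 : ℝ))) (Ioo (0 : ℝ) 1) :=
    (intervalIntegral.integrableOn_Ioo_rpow_iff zero_lt_one).mpr (by norm_num)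
  have h2 : IntervalIntegrable (fun x : ℝ => x ^ (-(1 / 2 : ℝ))) volume 0 1 :=
    (intervalIntegrable_iff_integrableOn_Ioo_of_le zero_le_one).mpr h1
  have h3 := (h2.comp_sub_left 1).symm
  simp only [sub_zero, sub_self] at h3
  exact (intervalIntegrable_iff_integrableOn_Ioo_of_le zero_le_one).mp h3

/-- `r (1 - r²)^{-1/2} ≤ (1 - r)^{-1/2}` on `(0,1)`, hence integrable there. -/
lemma integrableOn_radial :
    IntegrableOn (fun r : ℝ => r * (1 - r ^ 2) ^ (-(1 / 2 : ℝ))) (Ioo (0 : ℝ) 1) := by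
  refine integrableOn_one_sub_rpow.mono' ?_ ?_
  · refine ContinuousOn.aestronglyMeasurable ?_ measurableSet_Ioo
    refine continuousOn_id.mul (ContinuousOn.rpow_const (by fun_prop) fun r hr => Or.inl ?_)
    obtain ⟨hr0, hr1⟩ := hr
    have : r ^ 2 < 1 := by nlinarith
    linarith
  · rw [ae_restrict_iff' measurableSet_Ioo]
    refine Eventually.of_forall fun r hr => ?_
    obtain ⟨hr0, hr1⟩ := hr
    have hpos : 0 < 1 - r ^ 2 := by nlinarith
    have hle : 1 - r ≤ 1 - r ^ 2 := by nlinarith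
    have hnn : 0 ≤ r * (1 - r ^ 2) ^ (-(1 / 2 : ℝ)) := mul_nonneg hr0.le (Real.rpow_nonneg hpos.le _)
    rw [Real.norm_eq_abs, abs_of_nonneg hnn]
    calc r * (1 - r ^ 2) ^ (-(1 / 2 : ℝ)) ≤ 1 * (1 - r ^ 2) ^ (-(1 / 2 : ℝ)) := by
          gcongr
      _ = (1 - r ^ 2) ^ (-(1 / 2 : ℝ)) := one_mul _
      _ ≤ (1 - r) ^ (-(1 / 2 : ℝ)) := Real.rpow_le_rpow_of_nonpos (by linarith) hle (by norm_num)

/-! ### `∫_𝔻 (1 - |z|²)^{-1/2} dA < ∞` -/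

/-- `1 - |z|² > 0` on the disc. -/
lemma one_sub_norm_sq_pos {z : ℂ} (hz : z ∈ ball (0 : ℂ) 1) : 0 < 1 - ‖z‖ ^ 2 := by
  have := mem_ball_zero_iff.mp hz
  have h2 : ‖z‖ ^ 2 < 1 := by nlinarith [norm_nonneg z]
  linarith

/-- **The half-integer power is integrable on the disc**: `(1 - |z|²)^{-1/2} ∈ L¹(𝔻, dA)`. -/
theorem integrableOn_ball_rpow :
    IntegrableOn (fun z : ℂ => (1 - ‖z‖ ^ 2) ^ (-(1 / 2 : ℝ))) (ball (0 : ℂ) 1) := by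
  set F : ℂ → ℝ := fun z => (1 - ‖z‖ ^ 2) ^ (-(1 / 2 : ℝ)) with hF
  have hFc : ContinuousOn F (ball 0 1) :=
    ContinuousOn.rpow_const (by fun_prop) fun z hz => Or.inl (one_sub_norm_sq_pos hz).ne'
  refine ⟨hFc.aestronglyMeasurable measurableSet_ball, ?_⟩
  have hnn : 0 ≤ᵐ[volume.restrict (ball (0 : ℂ) 1)] F :=
    ae_restrict_of_forall_mem measurableSet_ball fun z hz =>
      Real.rpow_nonneg (one_sub_norm_sq_pos hz).le _
  rw [hasFiniteIntegral_iff_ofReal hnn, lintegral_ball_eq_polar F hFc]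
  -- the inner integral over the angle is constant
  have hin : ∀ r ∈ Ioo (0 : ℝ) 1, ∫⁻ θ in Ioo (-π) π, ENNReal.ofReal (r * F (circleMap 0 r θ)) =
      ENNReal.ofReal (r * (1 - r ^ 2) ^ (-(1 / 2 : ℝ))) * ENNReal.ofReal (2 * π) := by
    intro r hr
    have e : ∀ θ : ℝ, F (circleMap 0 r θ) = (1 - r ^ 2) ^ (-(1 / 2 : ℝ)) := by
      intro θ
      simp only [hF]
      rw [norm_circleMap_zero, sq_abs]
    simp_rw [e]
    rw [setLIntegral_const, Real.volume_Ioo]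
    congr 2
    ring
  rw [setLIntegral_congr_fun measurableSet_Ioo hin, lintegral_mul_const' _ _ ENNReal.ofReal_ne_top]
  refine ENNReal.mul_lt_top ?_ ENNReal.ofReal_lt_top
  have hrad := integrableOn_radial
  have hnn' : 0 ≤ᵐ[volume.restrict (Ioo (0 : ℝ) 1)] fun r : ℝ => r * (1 - r ^ 2) ^ (-(1 / 2 : ℝ)) := by
    refine ae_restrict_of_forall_mem measurableSet_Ioo fun r hr => ?_
    obtain ⟨hr0, hr1⟩ := hr
    have hpos : 0 < 1 - r ^ 2 := by nlinarith
    exact mul_nonneg hr0.le (Real.rpow_nonneg hpos.le _)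
  exact (hasFiniteIntegral_iff_ofReal hnn').mp hrad.hasFiniteIntegral

/-! ### Through the Poincaré measure and the fibration -/

/-- `(1 - |z|²)^{3/2}` is `poincare`-integrable. -/
lemma integrable_rpow_poincare :
    Integrable (fun z : ℂ => (1 - ‖z‖ ^ 2) ^ ((3 : ℝ) / 2)) poincare := by
  have hd : Measurable fun z : ℂ => Real.toNNReal (dens z) := measurable_dens.real_toNNReal
  have e : poincare = (volume.restrict (ball 0 1)).withDensity
      fun z => ((Real.toNNReal (dens z) : ℝ≥0) : ℝ≥0∞) := rfl
  rw [e, integrable_withDensity_iff_integrable_smul hd]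
  refine integrableOn_ball_rpow.congr_fun ?_ measurableSet_ball
  intro z hz
  simp only
  rw [NNReal.smul_def, Real.coe_toNNReal _ (dens_nonneg z), smul_eq_mul, dens_eq_norm]
  have hpos := one_sub_norm_sq_pos hz
  have e2 : (1 - ‖z‖ ^ 2) ^ 2 = (1 - ‖z‖ ^ 2) ^ ((2 : ℕ) : ℝ) := (Real.rpow_natCast _ 2).symm
  rw [e2, one_div ((1 - ‖z‖ ^ 2) ^ ((2 : ℕ) : ℝ)), ← Real.rpow_neg hpos.le, ← Real.rpow_add hpos]
  congr 1
  norm_num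

/-- `|a(s(z) · rot u)|^{-3} = (1 - |z|²)^{3/2}` for `z ∈ 𝔻`. -/
lemma norm_mat_inv_cube_fib {z : ℂ} (hz : z ∈ ball (0 : ℂ) 1) (u : Circle) :
    ‖mat (fib (z, u)) 0 0‖⁻¹ ^ 3 = (1 - ‖z‖ ^ 2) ^ ((3 : ℝ) / 2) := by
  have h := one_sub_norm_orbit_sq (fib (z, u))
  rw [orbit_fib hz u] at h
  have hnn : 0 ≤ ‖mat (fib (z, u)) 0 0‖⁻¹ := by positivity
  rw [h, ← Real.rpow_natCast _ 2, ← Real.rpow_natCast _ 3, ← Real.rpow_mul hnn]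
  congr 1
  norm_num

variable [MeasurableSpace Circle] [BorelSpace Circle]

/-- **`|a(g)|^{-3}` is integrable** against every Haar measure of `SU(1,1)`. -/
theorem integrable_norm_mat_inv_pow_three (μ : Measure SU11) [IsHaarMeasure μ] :
    Integrable (fun g => ‖mat g 0 0‖⁻¹ ^ 3) μ := by
  set F : SU11 → ℝ := fun g => ‖mat g 0 0‖⁻¹ ^ 3 with hF
  have hcF : Continuous F :=
    (continuous_mat00.norm.inv₀ fun g => (norm_pos_iff.mpr (mat_zero_zero_ne_zero g)).ne').pow 3
  set c := haarScalarFactor (nu haarCircle) μ with hc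
  have hc0 : c ≠ 0 := (haarScalarFactor_nu_pos haarCircle μ).ne'
  have hnu : nu haarCircle = c • μ := nu_eq_smul haarCircle μ
  have hmeas : AEStronglyMeasurable F (nu haarCircle) := hcF.aestronglyMeasurable
  have hint_nu : Integrable F (nu haarCircle) := by
    rw [nu, integrable_map_measure (by rw [← nu]; exact hmeas) measurable_fib.aemeasurable]
    have hae : (fun p : ℂ × Circle => (1 - ‖p.1‖ ^ 2) ^ ((3 : ℝ) / 2)) =ᵐ[poincare.prod haarCircle]
        (F ∘ fib) := by
      have hnull : (poincare.prod haarCircle) ((ball (0 : ℂ) 1)ᶜ ×ˢ (Set.univ : Set Circle)) = 0 := by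
        rw [Measure.prod_prod, poincare_compl_ball, zero_mul]
      rw [Filter.EventuallyEq, ae_iff]
      apply measure_mono_null _ hnull
      intro p hp
      simp only [Set.mem_setOf_eq] at hp
      refine ⟨?_, Set.mem_univ _⟩
      intro hball
      exact hp (by
        rw [Function.comp_apply, show fib p = fib (p.1, p.2) from rfl, hF]
        simp only
        rw [norm_mat_inv_cube_fib hball p.2])
    exact (integrable_rpow_poincare.comp_fst haarCircle).congr hae
  rw [hnu] at hint_nu
  exact (integrable_smul_measure (ENNReal.coe_ne_zero.mpr hc0) ENNReal.coe_ne_top).mp hint_nu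

/-- **The `K`-finite matrix coefficients of `π₃⁺` are integrable**: `g ↦ ⟨π_3(g) zᵐ, zⁿ⟩_3` is integrable
against every Haar measure of `SU(1,1)`. -/
theorem integrable_matrixCoeff_monomial_monomial_three (μ : Measure SU11) [IsHaarMeasure μ] (m n : ℕ) :
    Integrable (matrixCoeff 3 (fun z => z ^ m) (fun z => z ^ n)) μ := by
  have hcont : Continuous (matrixCoeff 3 (fun z => z ^ m) (fun z => z ^ n)) :=
    continuous_matrixCoeff_of_differentiableOn 3 (by norm_num) _ (differentiableOn_monomial m)
      (integrableOn_monomial 3 m) _ (differentiableOn_monomial n) (integrableOn_monomial 3 n)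
  refine ((integrable_norm_mat_inv_pow_three μ).const_mul (decayConst 3 m n * monomialNormSq 3 n)).mono'
    hcont.aestronglyMeasurable (Eventually.of_forall fun g => ?_)
  exact norm_matrixCoeff_monomial_monomial_le 3 (by norm_num) g m n

/-- **`π_k` is an integrable representation for every `k ≥ 3`**: the `K`-finite coefficients are
integrable against every Haar measure (`k = 3` above, `k ≥ 4` by `T5BergmanIntegrableCoeff`). -/
theorem integrable_matrixCoeff_monomial_monomial_of_three_le (μ : Measure SU11) [IsHaarMeasure μ]
    (k : ℕ) (hk : 3 ≤ k) (m n : ℕ) :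
    Integrable (matrixCoeff k (fun z => z ^ m) (fun z => z ^ n)) μ := by
  rcases Nat.lt_or_ge k 4 with h | h
  · have : k = 3 := by omega
    subst this
    exact integrable_matrixCoeff_monomial_monomial_three μ m n
  · exact integrable_matrixCoeff_monomial_monomial μ k h m n

end Summit.Ventures.HodgeRepro2.T5BergmanIntegrableCoeffThree
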